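/-
Copyright: the b2b-balaban T⁴-continuum CRUX team, row NE7b leaf lineage `t4-ne7b-formalise-leaf-05` (gen 157). Project licence.
-/
import Literature.MathematicalPhysics.QuantumFieldTheory.Balaban1983to89.B9SectEKernel
import Summits.QuantumFields.BalabanUV.T4Continuum.Spine.NE7b.SqrtFormPerturbationLetters
import Mathlib.Analysis.Normed.Module.Basic

/-!
# THE (h2) SLOT IN SUMS-OF-SQUARED-SEMINORMS CURRENCY: IMS localisation by Young's inequality — no matrix `K_F`, no coordinates — for
# `F(x) = Σ_j Φ_j(x)²` with the commutator letter `Φ_j(h_s·x) ≤ |h_s(c_j)|·Φ_j(x) + ρ_{s,j}(x)`: `Σ_s F(h_s·x) ≤ (1+t)F(x) + (1+t⁻¹)Σ_{j,s}ρ_{s,j}(x)²`,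
# hence local floors `c_loc·N(h_s·x) ≤ F(h_s·x)` and `Σ_{j,s}ρ² ≤ εN` give `F(x) ≥ ((c_loc − (1+t⁻¹)ε)∕(1+t))·N(x)` in ANY size currency `N`;
# then `B9SectEKernel.gamma0_assembly` BY NAME with `N = ‖·‖²` (row NE7b, node U5c; residual (R2′) family (2), letter (ℓ1); kernel lemmas + junction)

Cell `pub-balaban`, sub-cell `t4`, spine estimate NE7b (`T4WeightBudget.RelWeightBound`; the cell's OWN estimate — NOT PRINTED in [Bałaban 1983–89],
NOT PROVED).  Crux-route work under `Spine/NE7b/`; NOTHING of Bałaban's is asserted; no `def`; zero `sorry`; no `T4Continuum/Support` leaf (FREEZE (0)).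
Imports (both with hub oleans): `Literature.….B9SectEKernel` (r1; `gamma0_assembly`) and this lineage's `…SqrtFormPerturbationLetters` (`sum_sq_local_le`,
the plaquette–bond double count); Mathlib `Analysis.Normed.Module.Basic` for §5's linear maps.

WHY.  `…AdmissibleFloorIMS` (this lineage, g153) proves the (h2) slot of print's `γ₀` assembly («covariant Lemma 2.4′», `HOME/b2b-balaban-r1/SectE-interface-proof.md`
§5.5–§5.6) with the IMS step done on the MATRIX `K_F` of the full covariant form (`B9SectEKernel.ims_lower`), so its (cov) letter is an identity of a QUADRATIC
form: `⟨h_s·x, K_F(h_s·x)⟩ = F′_s(u_s(h_s·x))`.  The row's E-side chain at `k = 1` (leaf-02's `…OneStepCurlFormDisplay`, `…CoarseCurlTransportLetters` (CCTL))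
writes the covariant curl functional as a NORM of an `𝔸`-valued plaquette element, `X_P(B) = ‖curl_V B(P)‖_𝔸`, and `Y ↦ Σ_P X_P(Y)²` is NOT a quadratic form
when `‖·‖_𝔸` is the C⋆-norm of `M_n(ℂ)`, `n ≥ 2` (the parallelogram law fails on `iE₁₁, iE₂₂`), while the B7 frame (`U1`, `NormOneClass`) cannot be re-run in
the Hilbert–Schmidt currency.  THIS FILE removes the matrix from the (h2) skeleton: IMS localisation for a SUM OF SQUARED SEMINORMS holds by Young's
inequality from the one commutator letter, at the price of the factor `(1+t)⁻¹` (print's constants are not sharp; Theorem E1's arithmetic is re-run in §6),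
so that CCTL's (ℓ1) and (cov)∕(iso) are consumed AS NORM STATEMENTS, in whichever single currency the instance runs (answer A-leaf05-g157-1 to leaf-02 g133).

WHAT IS PROVED ([folklore]; `E` any type of fields, `J` the finite index of the square-root functionals `Φ_j` — plaquette curls AND block averages of the FULL
form —, `ι` the cubes, `loc_s` the localisation `x ↦ h_s·x`, `w_s(j)` the cutoff's value at the reference bond of term `j`, `N` the size `Σ_c sz(x c)²`):
* §2 **`sum_sq_localised_le`** — `Σ_s w_s(j)² ≤ 1`, `Φ_j ≥ 0`, (comm) `Φ_j(loc_s x) ≤ |w_s(j)|Φ_j(x) + ρ_{s,j}(x)` ⊢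
  `Σ_s Σ_j Φ_j(loc_s x)² ≤ (1+t)Σ_j Φ_j(x)² + (1+t⁻¹)Σ_j Σ_s ρ_{s,j}(x)²` (Young `(a + b)² ≤ (1+t)a² + (1+t⁻¹)b²`, inline); **`ims_floor_of_commutator`** — + (err) `Σ_{j,s} ρ_{s,j}(x)² ≤ εN(x)` on `good`, (part)
  `Σ_s N(loc_s x) = N(x)`, (loc) `c_loc N(loc_s x) ≤ Σ_j Φ_j(loc_s x)²` for `good x`, (full) `Σ_j Φ_j(x)² ≤ F(x)` on `good` ⊢ `((c_loc − (1+t⁻¹)ε)∕(1+t))·N(x) ≤ F(x)`.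
* §3 the local step in `N`-currency (Lemma 5.5's shape, as in AFI §1–§2 but for an arbitrary size `N`): `half_sub_le_of_sqrt_letter` (`Σ_j(f_j − g_j)² ≤ δN`
  ⊢ `(Σ g²)∕2 − δN ≤ Σ f²` — CCTL's `sum_sq_X_sub_X1_le` ∕ SFPL's `pert_letter_of_local` is this `hfg`), `local_floor_N` (transport ∘ perturbation ∘ flat:
  `c_loc = c∕2 − δ`).
* §4 **`admissible_floor_seminorm`** — THE (h2) SLOT IN BINDER SHAPE: per cube the five letters (cov) `Σ_j Φ_j(loc_s x)² = F′_s(u_s(loc_s x))` (a NORM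
  identity term by term — CCTL `X_gaugeAct_eq`), (iso) `N′_s(u_s(loc_s x)) = N(loc_s x)`, (adm), (pert) `F⁰_s Y∕2 − δN′_s Y ≤ F′_s Y`, (flat) `cN′_s Y ≤ F⁰_s Y`
  on `good⁰_s`, plus §2's (comm)∕(err)∕(part)∕(full) ⊢ `∀ x, good x → ((c∕2 − δ − (1+t⁻¹)ε)∕(1+t))·N x ≤ F x`.
* §5 THE COMMUTATOR LETTER AND `ε` FROM LINEARITY (template for the instance): for bond fields `x : C → W`, terms `T_j x = Σ_{c ∈ inc j} R_{j,c}(x c)` with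
  `R_{j,c}` real-linear, `‖R_{j,c}v‖ ≤ ℓ‖v‖` (`ℓ = 1`: the rotations `R(u)` are contractions in `‖·‖_op` AND isometries in `‖·‖_HS`):
  **`norm_term_cutoff_le`** (`‖T_j(h_s·x)‖ ≤ |h_s(c_j)|‖T_j x‖ + ℓΣ_{c∈inc j}|h_s(c) − h_s(c_j)|‖x c‖`), `sum_le_card_mul_of_vanish`,
  **`ims_error_of_letters`** (`|h_s(c) − h_s(c_j)| ≤ λ` on `inc j`, `≤ μ` cubes non-constant on a term, `#inc j ≤ a`, `#{j : c ∈ inc j} ≤ b` ⊢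
  `Σ_j Σ_s (ℓΣ_{c∈inc j}|h_s(c) − h_s(c_j)|‖x c‖)² ≤ μℓ²λ²ab·Σ_c ‖x c‖²` — SFPL `sum_sq_local_le` BY NAME; `ε = μℓ²λ²ab`, `λ = c_h(L+1)∕M` in print).
* §6 **`gamma0_assembly_of_seminorm_ims`** — `gamma0_assembly` BY NAME on `E = (m → ℝ)`, `N = (· ⬝ᵥ ·)`, `loc_s x = h_s * x` (a quadratic partition
  of unity splits `⬝ᵥ`: `Σ_s ‖h_s·x‖² = ‖x‖²`, inline) with (h2) := §2: `(((c_loc − (1+t⁻¹)ε)∕(1+t) − κ₂)∕κ₁ − θ)‖B‖² ≤ ⟨B, (P − a − 𝒥)B⟩` on `good`; **`gamma0_value_ge_young_one`** —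
  Theorem E1's arithmetic at `t = 1`: `0 ≤ c`, `0 < κ₁ ≤ 40`, `κ₂ ≤ c∕16`, `δ ≤ c∕8`, `ε ≤ c∕16`, `θ ≤ c∕1280` ⊢ `c∕1280 ≤ ((c∕2 − δ − 2ε)∕2 − κ₂)∕κ₁ − θ`.
* §7 toy: one cube, `loc = id`, `w ≡ 1`, `ρ ≡ 0`, `Φ_j x = |x j|` on `Fin 2 → ℝ`: §2 gives `½‖x‖² ≤ ‖x‖²` at `t = 1` (`example`).

NOT HERE (honest): the letters BY VALUE at `k = 1` (CCTL's `τ`∕`8τ`, the flat floor in the chosen currency — `c` in HS, `c∕n` in `‖·‖_op` since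
`‖Z‖²_op ≥ ‖Z‖²_HS∕n` —, the partition's `λ, μ`, the average-part perturbation letter); (h1), (hJ); WHICH `F, good` print's step displays ((A3) ∕ (A1c),
NC-NE7b-α UNRULED).  BY-NAME EFFECT ON THE WALL: NONE ((h2) skeleton re-based; the wall is (R2)).  NE7b NOT PRINTED ∕ NOT PROVED; spine PROVED 0∕9;
rung (B)+1 on ONE finite T⁴ — NOT infinite volume, NOT the mass gap, NOT Clay.
HONEST DEPENDENCY: continuum YM on T⁴ ⇐ BetaPertH ∧ nine spine estimates (0/9 proved); BetaPertH ⇐ (D1) ∧ (D4) ∧ CAP+tail; G-an2-4 gates asym, D1 and NE2/3/4.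
-/

set_option autoImplicit false

noncomputable section

open Matrix Finset
open Literature.MathematicalPhysics.QuantumFieldTheory.Balaban1983to89.B9SectEKernel (gamma0_assembly)

namespace Summit.QuantumFields.BalabanUV.T4Continuum.NE7b.AdmissibleFloorSeminormIMS

/-! ## §2 IMS localisation for a sum of squared seminorms, from the commutator letter (§1 = Young's inequality, inlined) -/

section IMS

variable {E : Type*} {J ι : Type*} [Fintype J] [Fintype ι]

/-- **THE UPPER LOCALISATION INEQUALITY**: `Σ_s w_s(j)² ≤ 1` (the cutoffs' squares sum to at most one at the reference bond of each term), `Φ_j ≥ 0`,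
and the commutator letter `Φ_j(loc_s x) ≤ |w_s(j)|·Φ_j(x) + ρ_{s,j}(x)` ⊢ `Σ_s Σ_j Φ_j(loc_s x)² ≤ (1+t)·Σ_j Φ_j(x)² + (1+t⁻¹)·Σ_j Σ_s ρ_{s,j}(x)²`
— termwise Young, then `Σ_s w_s(j)² ≤ 1`. [folklore] -/
theorem sum_sq_localised_le (Φ : J → E → ℝ) (loc : ι → E → E) (w : ι → J → ℝ) (ρ : ι → J → E → ℝ)
    (hw : ∀ j, ∑ s, w s j ^ 2 ≤ 1) (hΦ : ∀ j y, 0 ≤ Φ j y)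
    (hcomm : ∀ s j x, Φ j (loc s x) ≤ |w s j| * Φ j x + ρ s j x)
    {t : ℝ} (ht : 0 < t) (x : E) :
    ∑ s, ∑ j, Φ j (loc s x) ^ 2 ≤ (1 + t) * ∑ j, Φ j x ^ 2 + (1 + t⁻¹) * ∑ j, ∑ s, ρ s j x ^ 2 := by
  have ht1 : 0 ≤ 1 + t := by linarith
  have ht' : t ≠ 0 := ht.ne'
  -- Young: `(a + b)² ≤ (1+t)a² + (1+t⁻¹)b²` (the difference is `t⁻¹(ta − b)²`)
  have young : ∀ a b : ℝ, (a + b) ^ 2 ≤ (1 + t) * a ^ 2 + (1 + t⁻¹) * b ^ 2 := by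
    intro a b
    have h : 0 ≤ t⁻¹ * (t * a - b) ^ 2 := by positivity
    have e : t⁻¹ * (t * a - b) ^ 2 = t * a ^ 2 - 2 * (a * b) + t⁻¹ * b ^ 2 := by
      field_simp
      ring
    nlinarith [h, e]
  -- termwise Young on the commutator letter
  have h1 : ∀ s j, Φ j (loc s x) ^ 2 ≤ (1 + t) * Φ j x ^ 2 * w s j ^ 2 + (1 + t⁻¹) * ρ s j x ^ 2 := by
    intro s j
    have hle : Φ j (loc s x) ^ 2 ≤ (|w s j| * Φ j x + ρ s j x) ^ 2 :=
      pow_le_pow_left₀ (hΦ j _) (hcomm s j x) 2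
    have hy := young (|w s j| * Φ j x) (ρ s j x)
    rw [mul_pow, sq_abs] at hy
    nlinarith [hle, hy]
  -- per term: sum over the cubes, `Σ_s w_s(j)² ≤ 1`
  have h2 : ∀ j, ∑ s, Φ j (loc s x) ^ 2 ≤ (1 + t) * Φ j x ^ 2 + (1 + t⁻¹) * ∑ s, ρ s j x ^ 2 := by
    intro j
    have hpos : 0 ≤ (1 + t) * Φ j x ^ 2 := mul_nonneg ht1 (sq_nonneg _)
    calc ∑ s, Φ j (loc s x) ^ 2 ≤ ∑ s, ((1 + t) * Φ j x ^ 2 * w s j ^ 2 + (1 + t⁻¹) * ρ s j x ^ 2) :=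
          Finset.sum_le_sum fun s _ => h1 s j
      _ = (1 + t) * Φ j x ^ 2 * ∑ s, w s j ^ 2 + (1 + t⁻¹) * ∑ s, ρ s j x ^ 2 := by
          rw [Finset.sum_add_distrib, Finset.mul_sum, Finset.mul_sum]
      _ ≤ (1 + t) * Φ j x ^ 2 * 1 + (1 + t⁻¹) * ∑ s, ρ s j x ^ 2 :=
          add_le_add (mul_le_mul_of_nonneg_left (hw j) hpos) le_rfl
      _ = (1 + t) * Φ j x ^ 2 + (1 + t⁻¹) * ∑ s, ρ s j x ^ 2 := by rw [mul_one]
  rw [Finset.sum_comm]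
  calc ∑ j, ∑ s, Φ j (loc s x) ^ 2 ≤ ∑ j, ((1 + t) * Φ j x ^ 2 + (1 + t⁻¹) * ∑ s, ρ s j x ^ 2) :=
        Finset.sum_le_sum fun j _ => h2 j
    _ = (1 + t) * ∑ j, Φ j x ^ 2 + (1 + t⁻¹) * ∑ j, ∑ s, ρ s j x ^ 2 := by
        rw [Finset.sum_add_distrib, Finset.mul_sum, Finset.mul_sum]

/-- **IMS FLOOR FROM THE COMMUTATOR LETTER** (Prop. 5.6's shape, currency-free): with the data of `sum_sq_localised_le`, a size `N : E → ℝ` split by the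
localisation (`Σ_s N(loc_s x) = N(x)`), the IMS error letter `Σ_j Σ_s ρ_{s,j}(x)² ≤ ε·N(x)` on `good`, LOCAL floors `c_loc·N(loc_s x) ≤ Σ_j Φ_j(loc_s x)²`
for every cube `s` and every `good x`, and `Σ_j Φ_j(x)² ≤ F(x)` on `good` (the full form is the curl form on the admissible subspace); then
`((c_loc − (1+t⁻¹)ε)∕(1+t))·N(x) ≤ F(x)` for every `good x`. [folklore] -/
theorem ims_floor_of_commutator (Φ : J → E → ℝ) (loc : ι → E → E) (w : ι → J → ℝ) (ρ : ι → J → E → ℝ)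
    (hw : ∀ j, ∑ s, w s j ^ 2 ≤ 1) (hΦ : ∀ j y, 0 ≤ Φ j y)
    (hcomm : ∀ s j x, Φ j (loc s x) ≤ |w s j| * Φ j x + ρ s j x)
    (N : E → ℝ) (good : E → Prop) {ε : ℝ} (hE : ∀ x, good x → ∑ j, ∑ s, ρ s j x ^ 2 ≤ ε * N x)
    (hN : ∀ x, ∑ s, N (loc s x) = N x)
    {cloc : ℝ} (hloc : ∀ s x, good x → cloc * N (loc s x) ≤ ∑ j, Φ j (loc s x) ^ 2)
    (F : E → ℝ) (hF : ∀ x, good x → ∑ j, Φ j x ^ 2 ≤ F x)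
    {t : ℝ} (ht : 0 < t) (x : E) (hx : good x) :
    (cloc - (1 + t⁻¹) * ε) / (1 + t) * N x ≤ F x := by
  have hup := sum_sq_localised_le Φ loc w ρ hw hΦ hcomm ht x
  have hlow : cloc * N x ≤ ∑ s, ∑ j, Φ j (loc s x) ^ 2 := by
    rw [← hN x, Finset.mul_sum]
    exact Finset.sum_le_sum fun s _ => hloc s x hx
  have h1t : 0 < 1 + t := by linarith
  have h1t' : 0 ≤ 1 + t⁻¹ := by positivity
  have hEt : (1 + t⁻¹) * ∑ j, ∑ s, ρ s j x ^ 2 ≤ (1 + t⁻¹) * (ε * N x) :=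
    mul_le_mul_of_nonneg_left (hE x hx) h1t'
  have hFt : (1 + t) * ∑ j, Φ j x ^ 2 ≤ (1 + t) * F x := mul_le_mul_of_nonneg_left (hF x hx) h1t.le
  rw [div_mul_eq_mul_div, div_le_iff₀ h1t]
  nlinarith [hup, hlow, hEt, hFt]

end IMS

/-! ## §3 The local step in `N`-currency (Lemma 5.5's shape for an arbitrary size functional) -/

section Local

variable {E E' : Type*} {J : Type*} [Fintype J]

/-- **THE (pert) LETTER FROM THE SQUARE-ROOT LETTER**: `Σ_j (f_j(Y) − g_j(Y))² ≤ δ·N(Y)` ⊢ `(Σ_j g_j(Y)²)∕2 − δ·N(Y) ≤ Σ_j f_j(Y)²` (termwise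
`y²∕2 − (x − y)² ≤ x²`).  In use: `g_j = X¹_j` (flat curl ∕ flat average), `f_j = X_j` (covariant ones at the local small gauge field), the hypothesis is
CCTL's `sum_sq_X_sub_X1_le` ∕ SFPL's `pert_letter_of_local` with `δ = (8τ)²·4·2(d−1)` and `N(Y) = Σ_c ‖Y c‖²`. [folklore] -/
theorem half_sub_le_of_sqrt_letter (f g : J → E' → ℝ) (N' : E' → ℝ) {δ : ℝ} (Y : E')
    (hfg : ∑ j, (f j Y - g j Y) ^ 2 ≤ δ * N' Y) :
    (∑ j, g j Y ^ 2) / 2 - δ * N' Y ≤ ∑ j, f j Y ^ 2 := by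
  have h : (∑ j, g j Y ^ 2) / 2 - ∑ j, (f j Y - g j Y) ^ 2 ≤ ∑ j, f j Y ^ 2 := by
    rw [Finset.sum_div, ← Finset.sum_sub_distrib]
    exact Finset.sum_le_sum fun j _ => by nlinarith [sq_nonneg (2 * f j Y - g j Y)]
  linarith

/-- **THE LOCAL STEP** (transport ∘ perturbation ∘ flat floor, sizes `N` on `E` and `N′` on `E′`): `u` carries `good` fields to `good⁰` fields with
`N′(uX) = N(X)` (iso) and `F_loc X = F′(uX)` (cov); on `good⁰`: `F⁰ Y∕2 − δN′Y ≤ F′ Y` (pert) and `cN′Y ≤ F⁰ Y` (flat); then `(c∕2 − δ)·N(X) ≤ F_loc X`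
on `good`. [folklore] -/
theorem local_floor_N (Floc : E → ℝ) (F' F0 : E' → ℝ) (u : E → E') (N : E → ℝ) (N' : E' → ℝ)
    (good : E → Prop) (good0 : E' → Prop) {c δ : ℝ}
    (hiso : ∀ X, good X → N' (u X) = N X) (hcov : ∀ X, good X → Floc X = F' (u X))
    (hadm : ∀ X, good X → good0 (u X))
    (hpert : ∀ Y, good0 Y → F0 Y / 2 - δ * N' Y ≤ F' Y) (hflat : ∀ Y, good0 Y → c * N' Y ≤ F0 Y)
    (X : E) (hX : good X) : (c / 2 - δ) * N X ≤ Floc X := by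
  rw [hcov X hX, ← hiso X hX]
  have h1 := hflat (u X) (hadm X hX)
  have h2 := hpert (u X) (hadm X hX)
  linarith

end Local

/-! ## §4 The (h2) slot in binder shape, seminorm currency -/

section Admissible

variable {E E' : Type*} {J ι : Type*} [Fintype J] [Fintype ι]

/-- **COVARIANT LEMMA 2.4′ IN SUMS-OF-SQUARED-SEMINORMS CURRENCY — THE (h2) SLOT OF `gamma0_assembly`, NO MATRIX.**  Data: the square-root functionals
`Φ_j` of the FULL covariant form (`Φ_j ≥ 0`), the localisation `loc_s` with reference weights `w_s(j)` (`Σ_s w_s(j)² ≤ 1`) and the commutator letter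
(comm), a size `N` split by the localisation (part), the IMS error letter (err) `Σ_{j,s} ρ_{s,j}(x)² ≤ εN(x)` on `good`; per cube `s`: the local gauge
`u_s : E → E′` into fields of size `N′_s` with (iso) `N′_s(u_s(loc_s x)) = N(loc_s x)`, the gauged form `F′_s` with (cov) `Σ_j Φ_j(loc_s x)² = F′_s(u_s(loc_s x))`
(a NORM identity term by term), (adm) `good x → good⁰_s(u_s(loc_s x))`, the flat form `F⁰_s` with (flat) `cN′_s Y ≤ F⁰_s Y` and (pert) `F⁰_s Y∕2 − δN′_s Y ≤ F′_s Y`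
on `good⁰_s`; and (full) `Σ_j Φ_j(x)² ≤ F(x)` on `good`.  Conclusion: `∀ x, good x → ((c∕2 − δ − (1+t⁻¹)ε)∕(1+t))·N x ≤ F x` — the hypothesis `h2` of
`B9SectEKernel.gamma0_assembly` once `N = (· ⬝ᵥ ·)` (§6), with `c_V := (c∕2 − δ − (1+t⁻¹)ε)∕(1+t)`. [folklore] -/
theorem admissible_floor_seminorm (Φ : J → E → ℝ) (loc : ι → E → E) (w : ι → J → ℝ) (ρ : ι → J → E → ℝ)
    (hw : ∀ j, ∑ s, w s j ^ 2 ≤ 1) (hΦ : ∀ j y, 0 ≤ Φ j y)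
    (hcomm : ∀ s j x, Φ j (loc s x) ≤ |w s j| * Φ j x + ρ s j x)
    (N : E → ℝ) (good : E → Prop) {ε : ℝ} (hE : ∀ x, good x → ∑ j, ∑ s, ρ s j x ^ 2 ≤ ε * N x)
    (hN : ∀ x, ∑ s, N (loc s x) = N x) {c δ : ℝ}
    (u : ι → E → E') (N' : ι → E' → ℝ) (F' F0 : ι → E' → ℝ) (good0 : ι → E' → Prop)
    (hiso : ∀ s x, good x → N' s (u s (loc s x)) = N (loc s x))
    (hcov : ∀ s x, good x → ∑ j, Φ j (loc s x) ^ 2 = F' s (u s (loc s x)))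
    (hadm : ∀ s x, good x → good0 s (u s (loc s x)))
    (hpert : ∀ s Y, good0 s Y → F0 s Y / 2 - δ * N' s Y ≤ F' s Y)
    (hflat : ∀ s Y, good0 s Y → c * N' s Y ≤ F0 s Y)
    (F : E → ℝ) (hF : ∀ x, good x → ∑ j, Φ j x ^ 2 ≤ F x) {t : ℝ} (ht : 0 < t) :
    ∀ x : E, good x → (c / 2 - δ - (1 + t⁻¹) * ε) / (1 + t) * N x ≤ F x := by
  intro x hx
  -- the local floors on the localised fields, cube by cube (Lemma 5.5's shape, with `X := loc_s x` read through `good x`)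
  have hloc : ∀ s x, good x → (c / 2 - δ) * N (loc s x) ≤ ∑ j, Φ j (loc s x) ^ 2 := by
    intro s x hx
    rw [hcov s x hx, ← hiso s x hx]
    have h1 := hflat s _ (hadm s x hx)
    have h2 := hpert s _ (hadm s x hx)
    linarith
  exact ims_floor_of_commutator Φ loc w ρ hw hΦ hcomm N good hE hN hloc F hF ht x hx

end Admissible

/-! ## §5 The commutator letter and the IMS error letter from linearity (template for the lattice instance) -/

section Commutator

variable {J ι C : Type*} [Fintype J] [Fintype ι] [Fintype C]
variable {W V : Type*} [NormedAddCommGroup W] [NormedSpace ℝ W] [NormedAddCommGroup V] [NormedSpace ℝ V]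

omit [Fintype J] [Fintype ι] [Fintype C] in
/-- **THE COMMUTATOR LETTER FROM LINEARITY**: a term `T_j x = Σ_{c ∈ inc j} R_{j,c}(x c)` built from real-linear maps with `‖R_{j,c} v‖ ≤ ℓ‖v‖`, and the
localised field `(h_s·x)(c) = h_s(c)•x(c)`; then for any reference bond `c_j`:
`‖T_j(h_s·x)‖ ≤ |h_s(c_j)|·‖T_j x‖ + ℓ·Σ_{c ∈ inc j} |h_s(c) − h_s(c_j)|·‖x c‖` (`T_j(h_s·x) = h_s(c_j)•T_j x + Σ_c (h_s(c) − h_s(c_j))•R_{j,c}(x c)`). [folklore] -/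
theorem norm_term_cutoff_le (inc : J → Finset C) (R : J → C → W →ₗ[ℝ] V) {ℓ : ℝ} (hR : ∀ j c v, ‖R j c v‖ ≤ ℓ * ‖v‖)
    (h : ι → C → ℝ) (ref : J → C) (x : C → W) (s : ι) (j : J) :
    ‖∑ c ∈ inc j, R j c (h s c • x c)‖ ≤
      |h s (ref j)| * ‖∑ c ∈ inc j, R j c (x c)‖ + ℓ * ∑ c ∈ inc j, |h s c - h s (ref j)| * ‖x c‖ := by
  have hsplit : ∑ c ∈ inc j, R j c (h s c • x c)
      = h s (ref j) • ∑ c ∈ inc j, R j c (x c) + ∑ c ∈ inc j, (h s c - h s (ref j)) • R j c (x c) := by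
    rw [Finset.smul_sum, ← Finset.sum_add_distrib]
    refine Finset.sum_congr rfl fun c _ => ?_
    rw [LinearMap.map_smul, ← add_smul, add_sub_cancel]
  rw [hsplit]
  refine (norm_add_le _ _).trans (add_le_add ?_ ?_)
  · rw [norm_smul, Real.norm_eq_abs]
  · refine (norm_sum_le _ _).trans ?_
    rw [Finset.mul_sum]
    refine Finset.sum_le_sum fun c _ => ?_
    rw [norm_smul, Real.norm_eq_abs]
    have := hR j c (x c)
    have habs := abs_nonneg (h s c - h s (ref j))
    nlinarith

omit [Fintype J] [Fintype C] in
/-- a sum whose terms vanish off a set of at most `μ` indices and are bounded by `M ≥ 0` is at most `μ·M`. [folklore] -/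
theorem sum_le_card_mul_of_vanish (p : ι → Prop) [DecidablePred p] (f : ι → ℝ) {M : ℝ} {μ : ℕ} (hM : 0 ≤ M)
    (hvan : ∀ s, ¬p s → f s = 0) (hle : ∀ s, f s ≤ M) (hμ : (Finset.univ.filter p).card ≤ μ) :
    ∑ s, f s ≤ μ * M := by
  classical
  have hsplit : ∑ s, f s = ∑ s ∈ Finset.univ.filter p, f s := by
    rw [Finset.sum_filter]
    refine Finset.sum_congr rfl fun s _ => ?_
    split_ifs with hs
    · rfl
    · exact hvan s hs
  rw [hsplit]
  calc ∑ s ∈ Finset.univ.filter p, f s ≤ ∑ _s ∈ Finset.univ.filter p, M := Finset.sum_le_sum fun s _ => hle s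
    _ = (Finset.univ.filter p).card * M := by rw [Finset.sum_const, nsmul_eq_mul]
    _ ≤ μ * M := mul_le_mul_of_nonneg_right (by exact_mod_cast hμ) hM

omit [NormedSpace ℝ W] in
/-- **THE IMS ERROR LETTER FROM FOUR SUB-LETTERS** (seminorm-currency twin of `…IMSErrorLetters.ims_row_le`): (Lip) `|h_s(c) − h_s(c_j)| ≤ λ` for
`c ∈ inc j`, (mult) at most `μ` cubes `s` whose cutoff is not constant on `inc j` against `c_j`, (count) `#inc j ≤ a`, `#{j : c ∈ inc j} ≤ b`, `0 ≤ λ` (any real `ℓ`)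
⊢ `Σ_j Σ_s (ℓ·Σ_{c∈inc j}|h_s(c) − h_s(c_j)|·‖x c‖)² ≤ μℓ²λ²ab·Σ_c ‖x c‖²` — the `hE` letter of §2∕§4 with `ε := μℓ²λ²ab` and `N(x) = Σ_c ‖x c‖²`
(`…SqrtFormPerturbationLetters.sum_sq_local_le` BY NAME for the double count). [folklore] -/
theorem ims_error_of_letters [DecidableEq C] (inc : J → Finset C) (h : ι → C → ℝ) (ref : J → C) {ℓ lam : ℝ} (hlam : 0 ≤ lam)
    (hlip : ∀ s j, ∀ c ∈ inc j, |h s c - h s (ref j)| ≤ lam)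
    {μ a b : ℕ} (hμ : ∀ j, (Finset.univ.filter fun s => ∃ c ∈ inc j, h s c ≠ h s (ref j)).card ≤ μ)
    (ha : ∀ j, (inc j).card ≤ a) (hb : ∀ c, (Finset.univ.filter fun j => c ∈ inc j).card ≤ b)
    (x : C → W) :
    ∑ j, ∑ s, (ℓ * ∑ c ∈ inc j, |h s c - h s (ref j)| * ‖x c‖) ^ 2 ≤
      μ * ℓ ^ 2 * lam ^ 2 * a * b * ∑ c, ‖x c‖ ^ 2 := by
  classical
  -- per term: at most `μ` cubes contribute, each at most `ℓ²λ²(Σ_{c∈inc j}‖x c‖)²`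
  have hterm : ∀ j, ∑ s, (ℓ * ∑ c ∈ inc j, |h s c - h s (ref j)| * ‖x c‖) ^ 2
      ≤ μ * (ℓ ^ 2 * lam ^ 2 * (∑ c ∈ inc j, ‖x c‖) ^ 2) := by
    intro j
    have hS : 0 ≤ ∑ c ∈ inc j, ‖x c‖ := Finset.sum_nonneg fun c _ => norm_nonneg _
    refine sum_le_card_mul_of_vanish (fun s => ∃ c ∈ inc j, h s c ≠ h s (ref j)) _ (by positivity) ?_ ?_ (hμ j)
    · intro s hs
      have hs' : ∀ c ∈ inc j, h s c = h s (ref j) := fun c hc => by_contra fun hne => hs ⟨c, hc, hne⟩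
      have h0 : ∑ c ∈ inc j, |h s c - h s (ref j)| * ‖x c‖ = 0 :=
        Finset.sum_eq_zero fun c hc => by rw [hs' c hc, sub_self, abs_zero, zero_mul]
      rw [h0, mul_zero, zero_pow two_ne_zero]
    · intro s
      have hbd : ∑ c ∈ inc j, |h s c - h s (ref j)| * ‖x c‖ ≤ lam * ∑ c ∈ inc j, ‖x c‖ := by
        rw [Finset.mul_sum]
        exact Finset.sum_le_sum fun c hc => mul_le_mul_of_nonneg_right (hlip s j c hc) (norm_nonneg _)
      have hnn : 0 ≤ ∑ c ∈ inc j, |h s c - h s (ref j)| * ‖x c‖ :=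
        Finset.sum_nonneg fun c _ => mul_nonneg (abs_nonneg _) (norm_nonneg _)
      rw [mul_pow]
      have := mul_le_mul hbd hbd hnn (mul_nonneg hlam hS)
      nlinarith [sq_nonneg ℓ]
  -- the double count over the incidence (SFPL)
  have hdc := SqrtFormPerturbationLetters.sum_sq_local_le inc (fun c => ‖x c‖) ha hb
  simp only [abs_norm] at hdc
  calc ∑ j, ∑ s, (ℓ * ∑ c ∈ inc j, |h s c - h s (ref j)| * ‖x c‖) ^ 2
      ≤ ∑ j, μ * (ℓ ^ 2 * lam ^ 2 * (∑ c ∈ inc j, ‖x c‖) ^ 2) := Finset.sum_le_sum fun j _ => hterm j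
    _ = μ * ℓ ^ 2 * lam ^ 2 * ∑ j, (∑ c ∈ inc j, ‖x c‖) ^ 2 := by rw [← Finset.mul_sum, ← Finset.mul_sum]; ring
    _ ≤ μ * ℓ ^ 2 * lam ^ 2 * (a * b * ∑ c, ‖x c‖ ^ 2) := mul_le_mul_of_nonneg_left hdc (by positivity)
    _ = μ * ℓ ^ 2 * lam ^ 2 * a * b * ∑ c, ‖x c‖ ^ 2 := by ring

end Commutator

/-! ## §6 `gamma0_assembly` BY NAME with (h2) supplied in seminorm currency; Theorem E1's arithmetic at `t = 1` -/

section Assembly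

variable {n m : Type*} [Fintype n] [Fintype m] [DecidableEq m] {J ι : Type*} [Fintype J] [Fintype ι]

/-- **PRINT's `γ₀′` WITH (h2) SUPPLIED IN SEMINORM CURRENCY.**  `B9SectEKernel.gamma0_assembly`'s data and hypotheses VERBATIM except `h2`, which is
replaced by §2's data on `E = (m → ℝ)` with `N = (· ⬝ᵥ ·)` and `loc_s x = h_s * x` for a quadratic partition of unity `{h_s}`: square-root functionals
`Φ_j ≥ 0` with reference weights `w` (`Σ_s w_s(j)² ≤ 1`) and the commutator letter, the error letter `ε`, local floors `c_loc` on the localised admissible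
fields, `Σ_j Φ_j² ≤ F` on `good`; conclusion `(((c_loc − (1+t⁻¹)ε)∕(1+t) − κ₂)∕κ₁ − θ)‖B‖² ≤ ⟨B, (P − a − 𝒥)B⟩` for admissible `B`. [folklore] -/
theorem gamma0_assembly_of_seminorm_ims (K : Matrix n n ℝ) (Q : Matrix m n ℝ) (a : ℝ) (H : Matrix n m ℝ) (P Jm : Matrix m m ℝ)
    (hQH : Q * H = 1) (hSH : (K + a • (Qᵀ * Q)) * H = Qᵀ * P) (good : (m → ℝ) → Prop)
    (F : (m → ℝ) → ℝ) {κ₁ κ₂ θ : ℝ} (hκ₁ : 0 < κ₁)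
    (h1 : ∀ A : n → ℝ, F (Q *ᵥ A) ≤ κ₁ * (A ⬝ᵥ (K *ᵥ A)) + κ₂ * ((Q *ᵥ A) ⬝ᵥ (Q *ᵥ A)))
    (hJ : ∀ B : m → ℝ, |B ⬝ᵥ (Jm *ᵥ B)| ≤ θ * (B ⬝ᵥ B))
    -- the (h2) data of §2 in the `⬝ᵥ` currency
    (Φ : J → (m → ℝ) → ℝ) (h : ι → m → ℝ) (hpart : ∀ i, ∑ s, h s i ^ 2 = 1) (w : ι → J → ℝ)
    (ρ : ι → J → (m → ℝ) → ℝ) (hw : ∀ j, ∑ s, w s j ^ 2 ≤ 1) (hΦ : ∀ j y, 0 ≤ Φ j y)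
    (hcomm : ∀ s j x, Φ j (h s * x) ≤ |w s j| * Φ j x + ρ s j x)
    {ε : ℝ} (hE : ∀ x, good x → ∑ j, ∑ s, ρ s j x ^ 2 ≤ ε * (x ⬝ᵥ x))
    {cloc : ℝ} (hloc : ∀ s x, good x → cloc * ((h s * x) ⬝ᵥ (h s * x)) ≤ ∑ j, Φ j (h s * x) ^ 2)
    (hF : ∀ x, good x → ∑ j, Φ j x ^ 2 ≤ F x) {t : ℝ} (ht : 0 < t)
    (B : m → ℝ) (hB : good B) :
    (((cloc - (1 + t⁻¹) * ε) / (1 + t) - κ₂) / κ₁ - θ) * (B ⬝ᵥ B) ≤ B ⬝ᵥ ((P - a • (1 : Matrix m m ℝ) - Jm) *ᵥ B) := by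
  -- (part): a quadratic partition of unity splits `⬝ᵥ`: `Σ_s ‖h_s·x‖² = ‖x‖²` (as `…AdmissibleFloorIMS.sum_dotProduct_localised`, re-derived inline)
  have hN : ∀ x : m → ℝ, ∑ s, (h s * x) ⬝ᵥ (h s * x) = x ⬝ᵥ x := by
    intro x
    simp only [dotProduct, Pi.mul_apply]
    rw [Finset.sum_comm]
    refine Finset.sum_congr rfl fun i _ => ?_
    have e : ∀ s, h s i * x i * (h s i * x i) = h s i ^ 2 * (x i * x i) := fun s => by ring
    simp_rw [e]
    rw [← Finset.sum_mul, hpart i, one_mul]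
  exact gamma0_assembly K Q a H P Jm hQH hSH good F hκ₁ h1
    (fun x hx => ims_floor_of_commutator Φ (fun s x => h s * x) w ρ hw hΦ hcomm (fun x => x ⬝ᵥ x) good hE
      hN hloc F hF ht x hx) hJ B hB

/-- **THEOREM E1's ARITHMETIC AT `t = 1`** (the seminorm skeleton's `c_V = (c∕2 − δ − 2ε)∕2`): `0 ≤ c`, `0 < κ₁ ≤ 40`, `κ₂ ≤ c∕16`, `δ ≤ c∕8`, `ε ≤ c∕16`,
`θ ≤ c∕1280` ⊢ `c∕1280 ≤ ((c∕2 − δ − (1 + 1⁻¹)ε)∕(1 + 1) − κ₂)∕κ₁ − θ` (`c_V ≥ c∕8`, `(c_V − κ₂)∕κ₁ ≥ c∕640`). [folklore] -/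
theorem gamma0_value_ge_young_one {c κ₁ κ₂ δ ε θ : ℝ} (hc : 0 ≤ c) (hκ₁ : 0 < κ₁) (hκ₁' : κ₁ ≤ 40)
    (hκ₂ : κ₂ ≤ c / 16) (hδ : δ ≤ c / 8) (hε : ε ≤ c / 16) (hθ : θ ≤ c / 1280) :
    c / 1280 ≤ ((c / 2 - δ - (1 + (1 : ℝ)⁻¹) * ε) / (1 + 1) - κ₂) / κ₁ - θ := by
  have hnum : c / 16 ≤ (c / 2 - δ - (1 + (1 : ℝ)⁻¹) * ε) / (1 + 1) - κ₂ := by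
    rw [inv_one]
    have : c / 8 ≤ (c / 2 - δ - (1 + 1) * ε) / (1 + 1) := by
      rw [le_div_iff₀ (by norm_num : (0 : ℝ) < 1 + 1)]
      linarith
    linarith
  have hq : c / 640 ≤ ((c / 2 - δ - (1 + (1 : ℝ)⁻¹) * ε) / (1 + 1) - κ₂) / κ₁ := by
    rw [le_div_iff₀ hκ₁]
    have : c / 640 * κ₁ ≤ c / 640 * 40 := mul_le_mul_of_nonneg_left hκ₁' (by positivity)
    linarith
  linarith

end Assembly

/-! ## §7 Toy: one cube, no localisation error — §2 at `t = 1` loses exactly the factor `½` -/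

section Toy

/- `E = Fin 2 → ℝ`, `J = Fin 2`, `ι = Unit`, `loc = id`, `w ≡ 1`, `ρ ≡ 0`, `Φ_j x = |x j|`, `N = ‖·‖²`, `F = Σ_j x_j²`, `c_loc = 1`, `ε = 0`, `t = 1`:
`(1 − 2·0)∕2 · ‖x‖² ≤ Σ_j x_j²`. -/
example (x : Fin 2 → ℝ) : (1 - (1 + (1 : ℝ)⁻¹) * 0) / (1 + 1) * (x ⬝ᵥ x) ≤ ∑ j, x j ^ 2 :=
  ims_floor_of_commutator (ι := Unit) (fun j (y : Fin 2 → ℝ) => |y j|) (fun _ y => y) (fun _ _ => (1 : ℝ))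
    (fun _ _ _ => (0 : ℝ)) (fun _ => by simp) (fun _ _ => abs_nonneg _)
    (fun _ _ _ => by simp) (fun y => y ⬝ᵥ y) (fun _ => True) (ε := 0)
    (fun _ _ => by simp) (fun _ => by simp) (cloc := 1)
    (fun _ y _ => by simp [dotProduct, pow_two]) (fun y => ∑ j, y j ^ 2)
    (fun y _ => by simp [sq_abs]) one_pos x trivial

end Toy

end Summit.QuantumFields.BalabanUV.T4Continuum.NE7b.AdmissibleFloorSeminormIMS

end
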